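import Mathlib.Data.Nat.ModEq
import Summits.AnomalousDissipation.AnomalousDissipation.Theorems.SawtoothPulseCascadeK1LocalisedCascadeCanonicalThinBlocks

/-!
# K1loc, line `Spectral` / thin start — helper: BLOCK CONSTANTS AND JUNK SUMS ON THE THIN GEOMETRY (head sums, tail constants, uniform cut-off ratio)

Helper file of the prover lane on the crux `K1LocalisedCascade` (stmt-AnomalousDissipation-19491), route `SawtoothPulseCascade`
(glue seat; numeric layer, companion of `…CanonicalThinBlocks`).  For a block family with an ARITHMETIC HEAD and a DOUBLING TAIL —
abstractly `Λ_{m+1} = Λ_m + s` for `m < H`, `Λ_{m+1} = 2Λ_m` for `m ≥ H` (the closed form `(Λ₀ + s·min(m,H))·2^{m−H}` of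
`…CanonicalThinBlocks` is one such family: `thin_blocks_succ_head/_tail`) — with the window top `Q₂^m = ⌊θ_n(GΛ_m − K)/θ_d⌋` and the
feed cut-off `Q₁^m = ⌊u′Λ_{m+1}/v′⌋`:
* §1 the window top grows at least like the margin: `Q₂^{m+1} ≥ Q₂^m + ⌊θ_nGs/θ_d⌋` on the head, `Q₂^{m+1} ≥ 2Q₂^m` on the tail; hence the
  cut-off FRACTION condition `c_d·u′Λ_{m+1} ≤ c_n·v′·Q₂^m` (input of `thin_r_le`) holds on EVERY block from its instances at `m = 0`, `m = H`
  and the increment condition `c_du′s ≤ c_nv′⌊θ_nGs/θ_d⌋` (`thin_frac_all`) ⇒ uniform cut-off ratio `r_m ≤ (c_d+c_n)/(c_d−c_n)` (`thin_r_le_all`);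
* §2 HEAD constants against the arithmetic margins `marg_m = (GΛ₀ − K) + Gsm`: `A_m ≤ c_H/((1−θ)marg_m)`, `τ_m ≤ π/((1−θ)marg_m)` with
  `c_H = (1−θ)K + (1+θ)GΛ_H`, and the HEAD SUMS `Σ_{m<H} A_mτ_m ≤ (πc_H/(1−θ)²)(1/marg₀² + 1/(marg₀Gs))`,
  `Σ_{m<H} A_m² ≤ (c_H²/(1−θ)²)(1/marg₀² + 1/(marg₀Gs))` (`sum_inv_sq_arith_le`);
* §3 TAIL constants: `A_{H+i} ≤ A*_tail = ((1−θ)K + (1+θ)GΛ_H)/((1−θ)(GΛ_H − K))` (the bound of `thin_A_le` is decreasing in `Λ`) and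
  `τ_{H+i} ≤ (π/((1−θ)(GΛ_H − K)))/2^i` — the doubling regime of `…BlockJunk.blockJunk_sum_le` / `…BlockBudgetSums.blockJunk_sum_le_sharp`
  at the floor `Λ_H` (re-index `m = H + i`).
Pure natural/real arithmetic; no definitions; no statement about the crux. [cite: Grafakos2014, Prop. 3.2.7 (3)] [problem: turb]
-/

-- `Summit.<Summit>.<Problem>`: single-conjunct summit, the duplicate namespace segment is deliberate.
set_option linter.dupNamespace false

noncomputable section

namespace Summit.AnomalousDissipation.AnomalousDissipation.Theorems.SawtoothPulseCascade.K1Window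

open Finset

/-! ## §1 Growth of the window top; the cut-off fraction on every block -/

/-- **Head growth of the window top**: `Λ′ = Λ + s` and `K ≤ GΛ` give `⌊θ_n(GΛ′−K)/θ_d⌋ ≥ ⌊θ_n(GΛ−K)/θ_d⌋ + ⌊θ_nGs/θ_d⌋`. [folklore] -/
theorem thin_Q₂_step_head {θn θd G K s Λ Λ' : ℕ} (hΛ' : Λ' = Λ + s) (hK : K ≤ G * Λ) :
    θn * (G * Λ - K) / θd + θn * (G * s) / θd ≤ θn * (G * Λ' - K) / θd := by
  have e : θn * (G * Λ' - K) = θn * (G * Λ - K) + θn * (G * s) := by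
    rw [hΛ', show G * (Λ + s) = G * Λ + G * s by ring, Nat.sub_add_comm hK]; ring
  rw [e]
  exact Nat.add_div_le_add_div _ _ _

/-- **Tail growth of the window top**: `Λ′ = 2Λ` gives `⌊θ_n(GΛ′−K)/θ_d⌋ ≥ 2⌊θ_n(GΛ−K)/θ_d⌋`. [folklore] -/
theorem thin_Q₂_step_tail {θn θd G K Λ Λ' : ℕ} (hΛ' : Λ' = 2 * Λ) :
    2 * (θn * (G * Λ - K) / θd) ≤ θn * (G * Λ' - K) / θd := by
  have h1 : 2 * (G * Λ - K) ≤ G * Λ' - K := by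
    rw [hΛ', show G * (2 * Λ) = 2 * (G * Λ) by ring]; omega
  calc 2 * (θn * (G * Λ - K) / θd) = θn * (G * Λ - K) / θd + θn * (G * Λ - K) / θd := by ring
    _ ≤ (θn * (G * Λ - K) + θn * (G * Λ - K)) / θd := Nat.add_div_le_add_div _ _ _
    _ = θn * (2 * (G * Λ - K)) / θd := by ring_nf
    _ ≤ θn * (G * Λ' - K) / θd := Nat.div_le_div_right (Nat.mul_le_mul_left _ h1)

/-- **The cut-off fraction on every block from three scalar facts**: for a block family with `Λ_{m+1} = Λ_m + s` (`m < H`),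
`Λ_{m+1} = 2Λ_m` (`m ≥ H`), `Λ₀ ≤ Λ_m` and `K ≤ GΛ₀`: if (i) `c_du′Λ_1 ≤ c_nv′Q₂^0`, (ii) `c_du′s ≤ c_nv′⌊θ_nGs/θ_d⌋`,
(iii) `c_du′Λ_{H+1} ≤ c_nv′Q₂^H`, then `c_du′Λ_{m+1} ≤ c_nv′Q₂^m` for EVERY `m` (`Q₂^m = ⌊θ_n(GΛ_m − K)/θ_d⌋`; the `hfrac` input of
`thin_r_le`). [folklore] -/
theorem thin_frac_all {Λb : ℕ → ℕ} {s H u' v' cn cd θn θd G K : ℕ}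
    (hhead : ∀ m, m < H → Λb (m + 1) = Λb m + s) (htail : ∀ m, H ≤ m → Λb (m + 1) = 2 * Λb m)
    (hge : ∀ m, Λb 0 ≤ Λb m) (hK : K ≤ G * Λb 0)
    (h0 : cd * (u' * Λb 1) ≤ cn * (v' * (θn * (G * Λb 0 - K) / θd)))
    (hinc : cd * (u' * s) ≤ cn * (v' * (θn * (G * s) / θd)))
    (hH : cd * (u' * Λb (H + 1)) ≤ cn * (v' * (θn * (G * Λb H - K) / θd))) (m : ℕ) :
    cd * (u' * Λb (m + 1)) ≤ cn * (v' * (θn * (G * Λb m - K) / θd)) := by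
  induction m with
  | zero => exact h0
  | succ n ih =>
    rcases lt_or_ge (n + 1) H with h | h
    · -- inside the head
      have hKn : K ≤ G * Λb n := hK.trans (Nat.mul_le_mul_left _ (hge n))
      have hQ := thin_Q₂_step_head (θn := θn) (θd := θd) (hhead n (Nat.lt_of_succ_lt h)) hKn
      rw [hhead (n + 1) h]
      calc cd * (u' * (Λb (n + 1) + s)) = cd * (u' * Λb (n + 1)) + cd * (u' * s) := by ring
        _ ≤ cn * (v' * (θn * (G * Λb n - K) / θd)) + cn * (v' * (θn * (G * s) / θd)) := Nat.add_le_add ih hinc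
        _ = cn * (v' * (θn * (G * Λb n - K) / θd + θn * (G * s) / θd)) := by ring
        _ ≤ cn * (v' * (θn * (G * Λb (n + 1) - K) / θd)) := Nat.mul_le_mul_left _ (Nat.mul_le_mul_left _ hQ)
    · rcases eq_or_lt_of_le h with h' | h'
      · subst h'; exact hH
      · -- inside the tail
        have hn : H ≤ n := Nat.le_of_lt_succ h'
        have hQ := thin_Q₂_step_tail (θn := θn) (θd := θd) (G := G) (K := K) (htail n hn)
        rw [htail (n + 1) (hn.trans (Nat.le_succ n))]
        calc cd * (u' * (2 * Λb (n + 1))) = 2 * (cd * (u' * Λb (n + 1))) := by ring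
          _ ≤ 2 * (cn * (v' * (θn * (G * Λb n - K) / θd))) := Nat.mul_le_mul_left _ ih
          _ = cn * (v' * (2 * (θn * (G * Λb n - K) / θd))) := by ring
          _ ≤ cn * (v' * (θn * (G * Λb (n + 1) - K) / θd)) := Nat.mul_le_mul_left _ (Nat.mul_le_mul_left _ hQ)

/-- **Uniform cut-off ratio on every block**: under the hypotheses of `thin_frac_all`, `v′, c_d > 0`, `c_n < c_d` and the separation
`Q₁^m < Q₂^m` on every block, `0 ≤ r_m ≤ (c_d + c_n)/(c_d − c_n)` for all `m` (`r_m = (Q₁^m + Q₂^m)/(Q₂^m − Q₁^m)`). [folklore] -/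
theorem thin_r_le_all {Λb : ℕ → ℕ} {s H u' v' cn cd θn θd G K : ℕ} (hv' : 0 < v') (hcd : 0 < cd) (hc : cn < cd)
    (hhead : ∀ m, m < H → Λb (m + 1) = Λb m + s) (htail : ∀ m, H ≤ m → Λb (m + 1) = 2 * Λb m)
    (hge : ∀ m, Λb 0 ≤ Λb m) (hK : K ≤ G * Λb 0)
    (h0 : cd * (u' * Λb 1) ≤ cn * (v' * (θn * (G * Λb 0 - K) / θd)))
    (hinc : cd * (u' * s) ≤ cn * (v' * (θn * (G * s) / θd)))
    (hH : cd * (u' * Λb (H + 1)) ≤ cn * (v' * (θn * (G * Λb H - K) / θd)))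
    (hQ : ∀ m, u' * Λb (m + 1) / v' < θn * (G * Λb m - K) / θd) (m : ℕ) :
    0 ≤ (((u' * Λb (m + 1) / v' : ℕ) : ℝ) + ((θn * (G * Λb m - K) / θd : ℕ) : ℝ)) /
        (((θn * (G * Λb m - K) / θd : ℕ) : ℝ) - ((u' * Λb (m + 1) / v' : ℕ) : ℝ)) ∧
      (((u' * Λb (m + 1) / v' : ℕ) : ℝ) + ((θn * (G * Λb m - K) / θd : ℕ) : ℝ)) /
          (((θn * (G * Λb m - K) / θd : ℕ) : ℝ) - ((u' * Λb (m + 1) / v' : ℕ) : ℝ)) ≤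
        ((cd : ℝ) + cn) / ((cd : ℝ) - cn) := by
  have hfrac := thin_frac_all hhead htail hge hK h0 hinc hH m
  refine ⟨?_, thin_r_le hv' hcd hc (hQ m) hfrac⟩
  have hlt : ((u' * Λb (m + 1) / v' : ℕ) : ℝ) < ((θn * (G * Λb m - K) / θd : ℕ) : ℝ) := by exact_mod_cast hQ m
  exact div_nonneg (by positivity) (by linarith)

/-! ## §2 Head constants and head sums -/

/-- **Head RATIO constant against the arithmetic margin**: for a head block (`Λ ≤ Λ_H`, `K < GΛ`, margin `GΛ − K = marg₀ + Gs·m`),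
`A ≤ c_H/((1−θ)(marg₀ + Gsm))` with `c_H = (1−θ)K + (1+θ)GΛ_H`. [folklore] -/
theorem thin_head_A_le {θn θd G K Λ ΛH : ℕ} {marg0 Gs : ℝ} {m : ℕ} (hθd : 0 < θd) (hθ : θn < θd) (hK : K < G * Λ)
    (hΛH : Λ ≤ ΛH) (hmarg : (G : ℝ) * Λ - K = marg0 + Gs * m) :
    (((K + θn * (G * Λ - K) / θd : ℕ) : ℝ) + ((Λ * G : ℕ) : ℝ)) /
        (((Λ * G : ℕ) : ℝ) - ((K + θn * (G * Λ - K) / θd : ℕ) : ℝ)) ≤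
      ((1 - (θn : ℝ) / θd) * K + (1 + (θn : ℝ) / θd) * ((G : ℝ) * ΛH)) / ((1 - (θn : ℝ) / θd) * (marg0 + Gs * m)) := by
  have h := thin_A_le hθd hθ hK
  have hden := thin_den_ge hθd hθ hK
  rw [hmarg] at h hden
  refine h.trans (div_le_div_of_nonneg_right ?_ hden.1.le)
  have hθ1 : 0 ≤ 1 + (θn : ℝ) / θd := by positivity
  have hΛr : (G : ℝ) * Λ ≤ (G : ℝ) * ΛH := by
    have : (Λ : ℝ) ≤ ΛH := by exact_mod_cast hΛH
    exact mul_le_mul_of_nonneg_left this (Nat.cast_nonneg _)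
  linarith [mul_le_mul_of_nonneg_left hΛr hθ1]

/-- **Head LAYER constant against the arithmetic margin**: `τ ≤ π/((1−θ)(marg₀ + Gsm))`. [folklore] -/
theorem thin_head_tau_le {θn θd G K Λ : ℕ} {marg0 Gs : ℝ} {m : ℕ} (hθd : 0 < θd) (hθ : θn < θd) (hK : K < G * Λ)
    (hmarg : (G : ℝ) * Λ - K = marg0 + Gs * m) :
    Real.pi / (((Λ * G : ℕ) : ℝ) - ((K + θn * (G * Λ - K) / θd : ℕ) : ℝ)) ≤
      Real.pi / ((1 - (θn : ℝ) / θd) * (marg0 + Gs * m)) := by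
  have h := thin_tau_le hθd hθ hK
  rwa [hmarg] at h

/-- **THE HEAD SUMS**: if on each head block `m < H` the constants satisfy `0 ≤ A_m ≤ c/((1−θ)(a + bm))` and
`0 ≤ τ_m ≤ π/((1−θ)(a + bm))` (`a, b > 0`, `θ < 1`, `c ≥ 0`), then
`Σ_{m<H} A_mτ_m ≤ (πc/(1−θ)²)·(1/a² + 1/(ab))` and `Σ_{m<H} A_m² ≤ (c²/(1−θ)²)·(1/a² + 1/(ab))`. [folklore] -/
theorem thin_head_sums_le {A τ : ℕ → ℝ} {a b c θ : ℝ} (H : ℕ) (ha : 0 < a) (hb : 0 < b) (hc : 0 ≤ c) (hθ1 : θ < 1)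
    (hA0 : ∀ m, m < H → 0 ≤ A m) (hA : ∀ m, m < H → A m ≤ c / ((1 - θ) * (a + b * m)))
    (hτ0 : ∀ m, m < H → 0 ≤ τ m) (hτ : ∀ m, m < H → τ m ≤ Real.pi / ((1 - θ) * (a + b * m))) :
    ∑ m ∈ range H, A m * τ m ≤ Real.pi * c / (1 - θ) ^ 2 * (1 / a ^ 2 + 1 / (a * b)) ∧
      ∑ m ∈ range H, A m ^ 2 ≤ c ^ 2 / (1 - θ) ^ 2 * (1 / a ^ 2 + 1 / (a * b)) := by
  have hS := sum_inv_sq_arith_le ha hb H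
  have h1θ : 0 < 1 - θ := by linarith
  have hx : ∀ m : ℕ, 0 < a + b * m := fun m => by positivity
  have e1 : ∀ m : ℕ, c / ((1 - θ) * (a + b * m)) * (Real.pi / ((1 - θ) * (a + b * m))) =
      Real.pi * c / (1 - θ) ^ 2 * (1 / (a + b * m) ^ 2) := fun m => by
    field_simp
  have e2 : ∀ m : ℕ, (c / ((1 - θ) * (a + b * m))) ^ 2 = c ^ 2 / (1 - θ) ^ 2 * (1 / (a + b * m) ^ 2) := fun m => by
    field_simp
  constructor
  · calc ∑ m ∈ range H, A m * τ m
        ≤ ∑ m ∈ range H, c / ((1 - θ) * (a + b * m)) * (Real.pi / ((1 - θ) * (a + b * m))) :=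
          sum_le_sum fun m hm => by
            have hm' := mem_range.mp hm
            exact mul_le_mul (hA m hm') (hτ m hm') (hτ0 m hm') (div_nonneg hc (by positivity))
      _ = Real.pi * c / (1 - θ) ^ 2 * ∑ m ∈ range H, 1 / (a + b * m) ^ 2 := by
          rw [mul_sum]; exact sum_congr rfl fun m _ => e1 m
      _ ≤ Real.pi * c / (1 - θ) ^ 2 * (1 / a ^ 2 + 1 / (a * b)) := mul_le_mul_of_nonneg_left hS (by positivity)
  · calc ∑ m ∈ range H, A m ^ 2 ≤ ∑ m ∈ range H, (c / ((1 - θ) * (a + b * m))) ^ 2 :=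
          sum_le_sum fun m hm => by
            have hm' := mem_range.mp hm
            exact pow_le_pow_left₀ (hA0 m hm') (hA m hm') 2
      _ = c ^ 2 / (1 - θ) ^ 2 * ∑ m ∈ range H, 1 / (a + b * m) ^ 2 := by
          rw [mul_sum]; exact sum_congr rfl fun m _ => e2 m
      _ ≤ c ^ 2 / (1 - θ) ^ 2 * (1 / a ^ 2 + 1 / (a * b)) := mul_le_mul_of_nonneg_left hS (by positivity)

/-! ## §3 Tail constants (doubling regime at the floor `Λ_H`) -/

/-- **The ratio bound of `thin_A_le` is decreasing in the fibre**: for `K < GΛ_H ≤ GΛ`,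
`((1−θ)K + (1+θ)GΛ)/((1−θ)(GΛ − K)) ≤ ((1−θ)K + (1+θ)GΛ_H)/((1−θ)(GΛ_H − K))` (`θ < 1`, `K ≥ 0`). [folklore] -/
theorem thin_Abound_antitone {θ K L LH : ℝ} (hθ1 : θ < 1) (hK0 : 0 ≤ K) (hK : K < LH) (hL : LH ≤ L) :
    ((1 - θ) * K + (1 + θ) * L) / ((1 - θ) * (L - K)) ≤ ((1 - θ) * K + (1 + θ) * LH) / ((1 - θ) * (LH - K)) := by
  have h1θ : 0 < 1 - θ := by linarith
  rw [div_le_div_iff₀ (by nlinarith) (by nlinarith)]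
  -- cross-multiplied: the difference is `(1−θ)·2K·(L − LH)·? ≥ 0`
  nlinarith [mul_nonneg (mul_nonneg h1θ.le hK0) (sub_nonneg.mpr hL),
    mul_nonneg h1θ.le (mul_nonneg (mul_nonneg h1θ.le hK0) (sub_nonneg.mpr hL))]

/-- **Tail RATIO constant**: for a tail block `Λ ≥ Λ_H` (`K < GΛ_H`),
`A ≤ A*_tail = ((1−θ)K + (1+θ)GΛ_H)/((1−θ)(GΛ_H − K))`. [folklore] -/
theorem thin_tail_A_le {θn θd G K Λ ΛH : ℕ} (hθd : 0 < θd) (hθ : θn < θd) (hK : K < G * ΛH) (hΛ : ΛH ≤ Λ) :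
    (((K + θn * (G * Λ - K) / θd : ℕ) : ℝ) + ((Λ * G : ℕ) : ℝ)) /
        (((Λ * G : ℕ) : ℝ) - ((K + θn * (G * Λ - K) / θd : ℕ) : ℝ)) ≤
      ((1 - (θn : ℝ) / θd) * K + (1 + (θn : ℝ) / θd) * ((G : ℝ) * ΛH)) / ((1 - (θn : ℝ) / θd) * ((G : ℝ) * ΛH - K)) := by
  have hKΛ : K < G * Λ := thin_K_lt_of_le hK hΛ
  have h := thin_A_le hθd hθ hKΛ
  have hθdr : (0 : ℝ) < θd := by exact_mod_cast hθd
  have hθ0 : (0 : ℝ) ≤ (θn : ℝ) / θd := by positivity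
  have hθ1 : (θn : ℝ) / θd < 1 := by rw [div_lt_one hθdr]; exact_mod_cast hθ
  have hKr : (K : ℝ) < (G : ℝ) * ΛH := by exact_mod_cast hK
  have hLr : (G : ℝ) * ΛH ≤ (G : ℝ) * Λ := by
    have : (ΛH : ℝ) ≤ Λ := by exact_mod_cast hΛ
    exact mul_le_mul_of_nonneg_left this (Nat.cast_nonneg _)
  exact h.trans (thin_Abound_antitone hθ1 (Nat.cast_nonneg _) hKr hLr)

/-- **Tail LAYER constant is geometric**: for `Λ = Λ_H·2^i` (`K < GΛ_H`),
`τ ≤ (π/((1−θ)(GΛ_H − K)))/2^i`. [folklore] -/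
theorem thin_tail_tau_le {θn θd G K ΛH : ℕ} (i : ℕ) (hθd : 0 < θd) (hθ : θn < θd) (hK : K < G * ΛH) :
    Real.pi / ((((ΛH * 2 ^ i) * G : ℕ) : ℝ) - ((K + θn * (G * (ΛH * 2 ^ i) - K) / θd : ℕ) : ℝ)) ≤
      Real.pi / ((1 - (θn : ℝ) / θd) * ((G : ℝ) * ΛH - K)) / 2 ^ i := by
  have hΛ : ΛH ≤ ΛH * 2 ^ i := Nat.le_mul_of_pos_right _ (by positivity)
  have hKΛ : K < G * (ΛH * 2 ^ i) := thin_K_lt_of_le hK hΛ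
  have h := thin_tau_le hθd hθ hKΛ
  have hden := thin_den_ge hθd hθ hK
  refine h.trans ?_
  rw [div_div]
  refine div_le_div_of_nonneg_left Real.pi_pos.le (by have := hden.1; positivity) ?_
  -- `(1−θ)(GΛ_H − K)·2^i ≤ (1−θ)(GΛ_H2^i − K)`
  have hθdr : (0 : ℝ) < θd := by exact_mod_cast hθd
  have h1θ : 0 ≤ 1 - (θn : ℝ) / θd := by
    have : (θn : ℝ) / θd < 1 := by rw [div_lt_one hθdr]; exact_mod_cast hθ
    linarith
  have h2i : (1 : ℝ) ≤ 2 ^ i := one_le_pow₀ (by norm_num)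
  have hK0 : (0 : ℝ) ≤ K := Nat.cast_nonneg _
  push_cast
  have : ((G : ℝ) * ΛH - K) * 2 ^ i ≤ (G : ℝ) * (ΛH * 2 ^ i) - K := by nlinarith
  calc (1 - (θn : ℝ) / θd) * ((G : ℝ) * ΛH - K) * 2 ^ i = (1 - (θn : ℝ) / θd) * (((G : ℝ) * ΛH - K) * 2 ^ i) := by ring
    _ ≤ (1 - (θn : ℝ) / θd) * ((G : ℝ) * (ΛH * 2 ^ i) - K) := mul_le_mul_of_nonneg_left this h1θ

/-- **Tail blocks of the closed-form family are `Λ_H·2^i`**: `(Λ₀ + s·min(H+i,H))·2^{H+i−H} = (Λ₀ + sH)·2^i`. [folklore] -/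
theorem thin_blocks_tail_shift (Λ0 s H i : ℕ) : (Λ0 + s * min (H + i) H) * 2 ^ (H + i - H) = (Λ0 + s * H) * 2 ^ i := by
  rw [thin_blocks_tail (Nat.le_add_right H i), Nat.add_sub_cancel_left]

/-- **Splitting a block sum into head and tail**: `Σ_{m<H+T} f(m) = Σ_{m<H} f(m) + Σ_{i<T} f(H+i)`. [folklore] -/
theorem sum_range_head_tail (f : ℕ → ℝ) (H T : ℕ) :
    ∑ m ∈ range (H + T), f m = ∑ m ∈ range H, f m + ∑ i ∈ range T, f (H + i) := by
  rw [sum_range_add]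

end Summit.AnomalousDissipation.AnomalousDissipation.Theorems.SawtoothPulseCascade.K1Window
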